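import Summits.HodgeConjecture.HodgeConjecture.Theorems.AnchorTransportVariationalHodgeConnectedBase
import Summits.HodgeConjecture.HodgeConjecture.Theorems.AnchorTransportVariationalHodgeRationalityAtOnePoint
import Summits.HodgeConjecture.HodgeConjecture.Theorems.AnchorTransportCurveChainPropagation
import Literature.AlgebraicGeometry.HodgeTheory.IsoTransport

/-!
# Route AnchorTransport — `VariationalHodge` (stmt-HodgeConjecture-1076): the essential form of the crux

Assembling `AnchorTransportVariationalHodgeConnectedBase` (the base hypotheses `IrreducibleSpace S.left`,
`Smooth S.hom` weaken to `PreconnectedSpace S.left`, `LocallyOfFiniteType S.hom`),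
`AnchorTransportVariationalHodgeRationalityAtOnePoint` (fibrewise rationality is decided at one fibre, over
smooth irreducible bases) and the transport engine `AnchorTransportCurveChainPropagation` (properties of
complex points propagating along smooth curves propagate over connected bases):

* `isRationalClass_fibre_of_isRationalClass_fibre_at_of_preconnectedSpace` — for a smooth projective
  family over a (PRE)CONNECTED `ℂ`-scheme locally of finite type and any `A ∈ Hᵏ(𝒳(ℂ); ℂ)`, rationality
  of `A|_{𝒳_s}` at one complex point gives it at every complex point (the curve engine fed with the
  smooth-affine-curve case of the rationality transport);
* `variationalHodge_iff_essentialForm` — **`AnchorTransport.VariationalHodge` is EQUIVALENT to its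
  essential form**: for every smooth projective family `f : 𝒳 ⟶ S` over a (pre)connected complex base
  locally of finite type and every `A ∈ H²ᵖ(𝒳(ℂ); ℂ)` whose fibre restrictions are all of Hodge type
  `(p,p)` and ONE of whose fibre restrictions is rational, algebraicity of `A|_{𝒳_{s₀}}` at one point
  gives algebraicity of `A|_{𝒳_s}` at every point. Of the crux's hypotheses, exactly connectedness of
  the base, the fibrewise Hodge-type condition, one rationality and the anchor are load-bearing
  (connectedness and the anchor cannot be dropped short of `HodgeConjecture` itself:
  `Cruxes/VariationalHodge/Disproof.lean`).
* `hodgeConjecture_of_variationalHodge_of_essentialAnchors` — the route's assembly with the anchor crux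
  in the matching weakest shape: granted the crux, `HodgeConjecture` follows once every rational `(p,p)`
  class `c` on a smooth projective `X` is `e^*(A|_{𝒳_{s₁}})` for an isomorphism `e : X ≅ 𝒳_{s₁}` onto a
  fibre of a smooth projective family over a connected base locally of finite type and a global class `A`
  with all fibre restrictions of type `(p,p)` and `A|_{𝒳_{s₀}}` algebraic for some `s₀` — no smoothness,
  irreducibility or fibrewise rationality to supply (the one rationality needed is that of `c`);
  `essentialAnchors_of_anchorExistence` — the route's `AnchorExistence` supplies such anchors (so the new
  assembly specialises to the route's deciding chain).

HONEST FRAMING: research route conditional on HC_CM; not a corollary; Q11.4-sentence-2 already refuted in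
dim ≥ 3. Nothing here bears on `HC_CM`; no case of the Hodge conjecture and no instance of the crux is
proved — hypotheses of the crux's statement are removed, both ways.
-/

noncomputable section

-- every declaration of this problem lives in `Summit.HodgeConjecture.HodgeConjecture.…` (summit = sub-problem)
set_option linter.dupNamespace false

open CategoryTheory AlgebraicGeometry TopologicalSpace
open Literature.AlgebraicGeometry.Motives Literature.AlgebraicGeometry.HodgeTheory
open Summit.HodgeConjecture.HodgeConjecture.Theses.AnchorTransport

namespace Summit.HodgeConjecture.HodgeConjecture.Theorems

/-! ### Rationality over connected bases -/

/-- **Rationality of `A|_{𝒳_s}` is decided at one fibre, over any connected base.** For a smooth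
projective family `f : 𝒳 ⟶ S` over a (pre)connected `ℂ`-scheme locally of finite type and
`A ∈ Hᵏ(𝒳(ℂ); ℂ)`: if `A|_{𝒳_{s₀}}` is rational for one complex point then `A|_{𝒳_s}` is rational for
every `s`. The property "`A|_{𝒳_s}` is rational" propagates along every smooth affine curve `g : C ⟶ S`
(restrict the family to `C`, identify fibres by `fiberOverFamilyPullbackIso` / `map_fiberι_familyPullback`,
and use `isRationalClass_fibre_of_isRationalClass_fibre_at_of_isAffine` on `C`), so the curve engine
`forall_complexPoints_of_curves` applies. [cite: VoisinHodgeII2003, §3.1.2] -/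
theorem isRationalClass_fibre_of_isRationalClass_fibre_at_of_preconnectedSpace {n k : ℕ}
    {𝒳 S : SchemeOver ℂ} (f : 𝒳 ⟶ S) (hf : IsSmoothProjectiveFamily f n) [PreconnectedSpace S.left]
    [LocallyOfFiniteType S.hom] (A : complexBetti 𝒳 k) {s₀ : ComplexPoints S}
    (h₀ : IsRationalClass (complexBetti.map (fiberι f s₀) k A)) (s : ComplexPoints S) :
    IsRationalClass (complexBetti.map (fiberι f s) k A) := by
  refine forall_complexPoints_of_curves (fun t => IsRationalClass (complexBetti.map (fiberι f t) k A))
    (fun C g hCaff hCirr hCsm _ a b ha => ?_) h₀ s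
  haveI := hCaff
  haveI := hCirr
  haveI := hCsm
  have ha' : IsRationalClass (complexBetti.map (fiberι (familyPullback.snd f g) a) k
      (complexBetti.map (familyPullback.fst f g) k A)) := by
    rw [map_fiberι_familyPullback]
    exact ha.map _
  have hb' := isRationalClass_fibre_of_isRationalClass_fibre_at_of_isAffine (familyPullback.snd f g)
    (hf.familyPullback_snd g) (complexBetti.map (familyPullback.fst f g) k A) ha' b
  rw [map_fiberι_familyPullback] at hb'
  have hid : complexBetti.map (fiberOverFamilyPullbackIso f g b).symm.hom k
      (complexBetti.map (fiberOverFamilyPullbackIso f g b).hom k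
        (complexBetti.map (fiberι f (AlgPoints.map g b)) k A)) =
      complexBetti.map (fiberι f (AlgPoints.map g b)) k A :=
    map_hom_map_inv_apply (fiberOverFamilyPullbackIso f g b).symm k _
  rw [← hid]
  exact hb'.map _

/-! ### The essential form of the crux -/

/-- **The essential form of `AnchorTransport.VariationalHodge`.** The crux is equivalent to: for every
smooth projective family `f : 𝒳 ⟶ S` of relative dimension `n` over a (PRE)CONNECTED `ℂ`-scheme LOCALLY
OF FINITE TYPE and every `A ∈ H²ᵖ(𝒳(ℂ); ℂ)` with ALL fibre restrictions of Hodge type `(p,p)` and ONE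
fibre restriction rational, if `A|_{𝒳_{s₀}}` is algebraic for one `s₀` then `A|_{𝒳_s}` is algebraic for
every `s`. (`→`: rationality spreads over the connected base,
`isRationalClass_fibre_of_isRationalClass_fibre_at_of_preconnectedSpace`, then
`variationalHodge_conclusion_of_preconnectedBase`; `←`: an irreducible space is preconnected, a smooth
structure map is locally of finite type.) -/
theorem variationalHodge_iff_essentialForm :
    VariationalHodge ↔
      ∀ ⦃n : ℕ⦄ ⦃𝒳 S : SchemeOver ℂ⦄ (f : 𝒳 ⟶ S), IsSmoothProjectiveFamily f n →
        PreconnectedSpace S.left → LocallyOfFiniteType S.hom →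
        ∀ (p : ℕ) (A : complexBetti 𝒳 (2 * p)),
        (∀ s : ComplexPoints S,
          IsOfHodgeType n (fiberOver f s) (2 * p) p p (complexBetti.map (fiberι f s) (2 * p) A)) →
        (∃ s₁ : ComplexPoints S, IsRationalClass (complexBetti.map (fiberι f s₁) (2 * p) A)) →
        (∃ s₀ : ComplexPoints S,
          complexBetti.map (fiberι f s₀) (2 * p) A ∈ algebraicClasses (fiberOver f s₀) p) →
        ∀ s : ComplexPoints S,
          complexBetti.map (fiberι f s) (2 * p) A ∈ algebraicClasses (fiberOver f s) p := by
  refine ⟨fun hV n 𝒳 S f hf hconn hlft p A hH hQ hs₀ s => ?_,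
    fun h n 𝒳 S f hf hirr hsm p A hA hs₀ s => ?_⟩
  · obtain ⟨s₁, hs₁⟩ := hQ
    haveI := hconn
    haveI := hlft
    exact variationalHodge_conclusion_of_preconnectedBase hV f hf hconn hlft p A
      (fun t => ⟨isRationalClass_fibre_of_isRationalClass_fibre_at_of_preconnectedSpace f hf A hs₁ t,
        hH t⟩) hs₀ s
  · haveI := hirr
    haveI := hsm
    obtain ⟨s₀, hs₀⟩ := hs₀
    exact h f hf inferInstance inferInstance p A (fun t => (hA t).2) ⟨s₀, (hA s₀).1⟩ ⟨s₀, hs₀⟩ s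

/-! ### The route's assembly with anchors in the essential form -/

/-- **`HodgeConjecture` from the crux and ESSENTIAL ANCHORS.** Granted `AnchorTransport.VariationalHodge`,
the Hodge conjecture follows as soon as every rational `(p,p)` class `c` on a smooth projective `X` of
dimension `n` is, up to an isomorphism `e : X ≅ 𝒳_{s₁}`, the value at `s₁` of a global class
`A ∈ H²ᵖ(𝒳(ℂ); ℂ)` on a smooth projective family `𝒳 ⟶ S` of relative dimension `n` over a
(PRE)CONNECTED base LOCALLY OF FINITE TYPE, with every `A|_{𝒳_s}` of Hodge type `(p,p)` and
`A|_{𝒳_{s₀}}` algebraic for some `s₀`. Compared with the route's `AnchorExistence`: no smoothness or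
irreducibility of the base and no fibrewise rationality are asked (the rationality at `s₁` is that of
`c`, moved along `e`). Assembly through `variationalHodge_iff_essentialForm`, `IsoInvariance_holds`,
`HodgeModels_holds`, `hodgeConjectureFor_iff_of_isSmoothProjective`. -/
theorem hodgeConjecture_of_variationalHodge_of_essentialAnchors (hV : VariationalHodge)
    (hAn : ∀ ⦃n : ℕ⦄ ⦃X : SchemeOver ℂ⦄, IsSmoothProjective n X →
      ∀ (p : ℕ) (c : complexBetti X (2 * p)), IsRationalClass c → IsOfHodgeType n X (2 * p) p p c →
      ∃ (𝒳 S : SchemeOver ℂ) (f : 𝒳 ⟶ S) (s₁ s₀ : ComplexPoints S) (e : X ≅ fiberOver f s₁)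
        (A : complexBetti 𝒳 (2 * p)),
        IsSmoothProjectiveFamily f n ∧ PreconnectedSpace S.left ∧ LocallyOfFiniteType S.hom ∧
        (∀ s : ComplexPoints S,
          IsOfHodgeType n (fiberOver f s) (2 * p) p p (complexBetti.map (fiberι f s) (2 * p) A)) ∧
        complexBetti.map e.hom (2 * p) (complexBetti.map (fiberι f s₁) (2 * p) A) = c ∧
        complexBetti.map (fiberι f s₀) (2 * p) A ∈ algebraicClasses (fiberOver f s₀) p) :
    _root_.HodgeConjecture := by
  intro n X hX
  refine (hodgeConjectureFor_iff_of_isSmoothProjective (HodgeModels_holds n X) hX).2 ?_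
  intro p c hc hpp
  obtain ⟨𝒳, S, f, s₁, s₀, e, A, hf, hconn, hlft, hH, hAc, hs₀⟩ := hAn hX p c hc hpp
  -- rationality of `A|_{𝒳_{s₁}} = (e⁻¹)^* c`
  have hrat : IsRationalClass (complexBetti.map (fiberι f s₁) (2 * p) A) := by
    have hid : complexBetti.map e.inv (2 * p) (complexBetti.map e.hom (2 * p)
        (complexBetti.map (fiberι f s₁) (2 * p) A)) = complexBetti.map (fiberι f s₁) (2 * p) A :=
      map_hom_map_inv_apply e.symm (2 * p) _
    rw [← hid, hAc]
    exact hc.map _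
  -- transport algebraicity from the anchor fibre `s₀` to `s₁` (essential form of the crux) …
  have h₁ := (variationalHodge_iff_essentialForm.1 hV) f hf hconn hlft p A hH ⟨s₁, hrat⟩ ⟨s₀, hs₀⟩ s₁
  -- … and across the isomorphism `e : X ≅ 𝒳_{s₁}`
  have h₂ := IsoInvariance_holds e p _ h₁
  rw [hAc] at h₂
  exact h₂

/-- **The route's `AnchorExistence` supplies essential anchors** (so
`hodgeConjecture_of_variationalHodge_of_essentialAnchors hV (essentialAnchors_of_anchorExistence hAn)`
recovers the route's deciding chain `closes hV hAn IsoInvariance_holds HodgeModels_holds`): an irreducible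
space is preconnected, a smooth structure map is locally of finite type, and the fibrewise rationality is
simply dropped. -/
theorem essentialAnchors_of_anchorExistence (hAn : AnchorExistence) :
    ∀ ⦃n : ℕ⦄ ⦃X : SchemeOver ℂ⦄, IsSmoothProjective n X →
      ∀ (p : ℕ) (c : complexBetti X (2 * p)), IsRationalClass c → IsOfHodgeType n X (2 * p) p p c →
      ∃ (𝒳 S : SchemeOver ℂ) (f : 𝒳 ⟶ S) (s₁ s₀ : ComplexPoints S) (e : X ≅ fiberOver f s₁)
        (A : complexBetti 𝒳 (2 * p)),
        IsSmoothProjectiveFamily f n ∧ PreconnectedSpace S.left ∧ LocallyOfFiniteType S.hom ∧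
        (∀ s : ComplexPoints S,
          IsOfHodgeType n (fiberOver f s) (2 * p) p p (complexBetti.map (fiberι f s) (2 * p) A)) ∧
        complexBetti.map e.hom (2 * p) (complexBetti.map (fiberι f s₁) (2 * p) A) = c ∧
        complexBetti.map (fiberι f s₀) (2 * p) A ∈ algebraicClasses (fiberOver f s₀) p := by
  intro n X hX p c hc hpp
  obtain ⟨𝒳, S, f, s₁, s₀, e, A, hf, hirr, hsm, hfib, hAc, hs₀⟩ := hAn hX p c hc hpp
  haveI := hirr
  haveI := hsm
  exact ⟨𝒳, S, f, s₁, s₀, e, A, hf, inferInstance, inferInstance, fun s => (hfib s).2, hAc, hs₀⟩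

end Summit.HodgeConjecture.HodgeConjecture.Theorems

end
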